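import Literature.MathematicalPhysics.KineticTheory.HardSphereEulerLLN
import Literature.MathematicalPhysics.KineticTheory.HardSphereCanonicalPairBound
import Literature.Analysis.FluidPDE.HardSphereTorusMeasure
import Mathlib.MeasureTheory.Integral.Marginal
import HarnessLib

/-!
# Floor statics: the layer inequality (swap transport) for the canonical hard-sphere gas

Supporting file of the line `Sketch` for the crux `AprioriBounds` (stmt-AtomisticToContinuum-14827;
`Summit.AtomisticToContinuum.HydrodynamicLimit.Theses.StiffCollisionalRelaxation.AprioriBounds`), lead
prover `prover-line-stmt-AtomisticToContinuum-14827-c2-0`.  It serves the registered stub `stub_floorFixed`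
(the fixed-`(s, x)` mesoscopic FLOOR bound of component (ii) of the crux, "no mesoscopic cell is ever
empty") by delivering the combinatorial heart of the STATIC INPUT of its equilibrium rung: the **layer
inequality** of the canonical gas of `N + 1` hard spheres of diameter `ε = ε_N = hsDiameter σ N` on `𝕋³`,
`P = posGibbsMeasure 1 ε (N+1)`.  For a minimal-image ball `A = B(c, r)`, its enlargement `A⁺ = B(c, r + ε)`,
the occupation numbers `#A(x) = ∑ᵢ 𝟙_A(xᵢ)`, `#A⁺(x)`, the volume `v` of an `ε`-ball, `M ≥ 0` and `j ∈ ℕ`,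
`(vol A − M v) · ((N+1) − j) · P{#A = j, #A⁺ ≤ M} ≤ (j+1) · P{#A = j+1}` (`floorStat_layer_ineq`; quantifier
form `floorStat_layer_hKI`, the sub-goal registered on the crux item for this file, consumed verbatim by the
sibling tail file, which iterates it over `j`).

Proof (swap transport; `ℙ = vol^{⊗(N+1)}`, `HC` the hard-core set, `E = {#A = j, #A⁺ ≤ M} ∩ HC`,
`E' = {#A = j+1} ∩ HC`).  §1 SWAP IDENTITY (`floorStat_lintegral_update_swap`, generic): for a product
measure `μ^{⊗ι}` and a measurable `F ≥ 0`, `∫∫ F(update x i y, xᵢ) dμ(y) dμ^{⊗ι}(x) = ∫∫ F(x, y) dμ(y) dμ^{⊗ι}(x)`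
— the `{i}`-marginals agree (`lmarginal_singleton`, Tonelli), hence so do the integrals
(`lintegral_eq_of_lmarginal_eq`).  §2 POINTWISE TRANSPORT (`floorStat_update_mem_layer`): if `x ∈ E`,
`xᵢ ∉ A`, `y ∈ A` and `y` is `ε`-compatible with all `x_l`, `l ≠ i`, then `update x i y ∈ E'`.  §3 EXCLUDED
VOLUME (`floorStat_volume_good_ge`): for `#A⁺(x) ≤ M` the compatible part of `A` has volume `≥ vol A − M v`
(an incompatible `y ∈ A` is `ε`-close to some `x_l ∈ A⁺`, triangle inequality).  §4 TRANSPORT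
(`floorStat_key`): summing over the label `i`, `(vol A − M v)((N+1) − j) ℙ(E) ≤ ∑ᵢ ∫∫ 𝟙_{E'}(update x i y) 𝟙_A(y)
= ∑ᵢ ∫ 𝟙_{E'}(x) 𝟙_A(xᵢ) = (j+1) ℙ(E')`.  §5 (`floorStat_layer_ineq`): `P = Ξ⁻¹ ℙ|_{HC}` (`posGibbsMeasure_eq`,
`profileOf_one_μ`), all `ε`-balls have the volume `v` (`Torus.volume_euclidDist_lt`, `ε ≤ σ < 1/2`), and the
degenerate signs are trivial.  No new definitions, no named facts; axioms `propext`, `Classical.choice`,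
`Quot.sound`.
-/

noncomputable section

namespace Summit.AtomisticToContinuum.HydrodynamicLimit.Theorems.AdiabatCeiling

open MeasureTheory Finset Filter Set Function Literature.MathematicalPhysics.KineticTheory
  Literature.MathematicalPhysics.StatisticalMechanics Literature.Analysis.FluidPDE
open scoped ENNReal

/-! ## §1 The swap identity -/

/-- **Swap identity.**  For a product measure `μ^{⊗ι}` (`μ` σ-finite) and a measurable
`F : (ι → X) → X → ℝ≥0∞`, replacing the `i`-th coordinate by a fresh variable and feeding the old coordinate
as the extra argument does not change the iterated integral:
`∫∫ F(update x i y, xᵢ) dμ(y) dμ^{⊗ι}(x) = ∫∫ F(x, y) dμ(y) dμ^{⊗ι}(x)`.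
Both sides have the same `{i}`-marginal (Tonelli in the two variables `(xᵢ, y)`). -/
theorem floorStat_lintegral_update_swap {ι X : Type*} [Fintype ι] [DecidableEq ι] [MeasurableSpace X]
    (μ : Measure X) [SigmaFinite μ] {F : (ι → X) → X → ℝ≥0∞} (hF : Measurable (uncurry F)) (i : ι) :
    ∫⁻ x, ∫⁻ y, F (update x i y) (x i) ∂μ ∂Measure.pi (fun _ => μ) =
      ∫⁻ x, ∫⁻ y, F x y ∂μ ∂Measure.pi (fun _ => μ) := by
  have h1 : Measurable fun p : (ι → X) × X => F (update p.1 i p.2) (p.1 i) :=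
    hF.comp (measurable_update'.prodMk ((measurable_pi_apply i).comp measurable_fst))
  have hH : Measurable fun x : ι → X => ∫⁻ y, F (update x i y) (x i) ∂μ := h1.lintegral_prod_right'
  have hG : Measurable fun x : ι → X => ∫⁻ y, F x y ∂μ := hF.lintegral_prod_right
  refine lintegral_eq_of_lmarginal_eq {i} hH hG (funext fun x => ?_)
  have h2 : Measurable fun p : X × X => F (update x i p.2) p.1 :=
    hF.comp (((measurable_update x).comp measurable_snd).prodMk measurable_fst)
  simp only [lmarginal_singleton, update_idem, update_self]
  exact lintegral_lintegral_swap (f := fun a y => F (update x i y) a) h2.aemeasurable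

/-! ## §2 Occupation numbers and the pointwise transport -/

/-- The `ℝ≥0∞`-valued indicator of a set is `ENNReal.ofReal` of its real indicator. -/
theorem floorStat_indicator_ennreal (A : Set T3) (t : T3) :
    A.indicator (1 : T3 → ℝ≥0∞) t = ENNReal.ofReal (A.indicator (fun _ => (1 : ℝ)) t) := by
  by_cases ht : t ∈ A
  · rw [indicator_of_mem ht, indicator_of_mem ht, Pi.one_apply, ENNReal.ofReal_one]
  · rw [indicator_of_notMem ht, indicator_of_notMem ht, ENNReal.ofReal_zero]

/-- Occupation numbers in `ℝ≥0∞` and in `ℝ` agree: `∑ₗ 𝟙_A(x_l) = ofReal (∑ₗ 𝟙_A(x_l))`. -/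
theorem floorStat_sum_indicator_ennreal {n : ℕ} (A : Set T3) (x : Fin n → T3) :
    ∑ l, A.indicator (1 : T3 → ℝ≥0∞) (x l) =
      ENNReal.ofReal (∑ l, A.indicator (fun _ => (1 : ℝ)) (x l)) := by
  rw [ENNReal.ofReal_sum_of_nonneg fun l _ => Set.indicator_nonneg (fun _ _ => zero_le_one) _]
  exact Finset.sum_congr rfl fun l _ => floorStat_indicator_ennreal A (x l)

/-- The complementary occupation number: `∑ₗ 𝟙_{Aᶜ}(x_l) = n − ∑ₗ 𝟙_A(x_l)`. -/
theorem floorStat_sum_indicator_compl {n : ℕ} (A : Set T3) (x : Fin n → T3) :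
    ∑ l, Aᶜ.indicator (fun _ => (1 : ℝ)) (x l) = n - ∑ l, A.indicator (fun _ => (1 : ℝ)) (x l) := by
  have h : ∀ t, Aᶜ.indicator (fun _ => (1 : ℝ)) t = 1 - A.indicator (fun _ => (1 : ℝ)) t := by
    intro t
    by_cases ht : t ∈ A
    · rw [indicator_of_mem ht, indicator_of_notMem (notMem_compl_iff.2 ht), sub_self]
    · rw [indicator_of_notMem ht, indicator_of_mem (mem_compl ht), sub_zero]
  simp only [h, Finset.sum_sub_distrib, Finset.sum_const, Finset.card_univ, Fintype.card_fin,
    nsmul_eq_mul, mul_one]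

/-- **Occupation number after a swap**: replacing the `i`-th particle by `y` changes `#A` by
`𝟙_A(y) − 𝟙_A(xᵢ)`. -/
theorem floorStat_sum_indicator_update {n : ℕ} (A : Set T3) (x : Fin n → T3) (i : Fin n) (y : T3) :
    (∑ l, A.indicator (fun _ => (1 : ℝ)) (update x i y l)) + A.indicator (fun _ => (1 : ℝ)) (x i) =
      (∑ l, A.indicator (fun _ => (1 : ℝ)) (x l)) + A.indicator (fun _ => (1 : ℝ)) y := by
  rw [Finset.sum_eq_add_sum_sdiff_singleton_of_mem (mem_univ i) fun l =>
      A.indicator (fun _ => (1 : ℝ)) (update x i y l),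
    Finset.sum_eq_add_sum_sdiff_singleton_of_mem (mem_univ i) fun l => A.indicator (fun _ => (1 : ℝ)) (x l),
    update_self]
  have h : ∑ l ∈ univ \ {i}, A.indicator (fun _ => (1 : ℝ)) (update x i y l) =
      ∑ l ∈ univ \ {i}, A.indicator (fun _ => (1 : ℝ)) (x l) :=
    Finset.sum_congr rfl fun l hl => by
      rw [update_of_ne (Finset.notMem_singleton.1 (Finset.mem_sdiff.1 hl).2)]
  rw [h]
  ring

/-- **A compatible swap stays in the hard-core set**: if `x` has no overlapping pair and `y` overlaps no
`x_l`, `l ≠ i`, then `update x i y` has no overlapping pair. -/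
theorem floorStat_update_mem_hardCore {n : ℕ} {ε : ℝ} {x : Fin n → T3}
    (hx : x ∈ hardCoreSet (Ov ε) (univ : Finset (Fin n))) {i : Fin n} {y : T3}
    (hy : ∀ l, l ≠ i → ¬ Ov ε (x l) y) :
    update x i y ∈ hardCoreSet (Ov ε) (univ : Finset (Fin n)) := by
  intro a _ b _ hab
  by_cases ha : a = i
  · subst ha
    rw [update_self, update_of_ne (Ne.symm hab)]
    exact fun h => hy b (Ne.symm hab) (ov_symm ε _ _ h)
  · rw [update_of_ne ha]
    by_cases hb : b = i
    · subst hb; rw [update_self]; exact hy a ha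
    · rw [update_of_ne hb]; exact hx a (mem_univ a) b (mem_univ b) hab

/-- **Pointwise transport**: if `x ∈ E = {#A = j, #A⁺ ≤ M} ∩ HC`, `xᵢ ∉ A`, `y ∈ A` and `y` is compatible
with all `x_l`, `l ≠ i`, then `update x i y ∈ E' = {#A = j+1} ∩ HC`. -/
theorem floorStat_update_mem_layer {n : ℕ} {ε : ℝ} {A Ap : Set T3} {M : ℝ} {j : ℕ} {x : Fin n → T3}
    {i : Fin n} {y : T3}
    (hx : x ∈ {x : Fin n → T3 | (∑ l, A.indicator (fun _ => (1 : ℝ)) (x l)) = j ∧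
        (∑ l, Ap.indicator (fun _ => (1 : ℝ)) (x l)) ≤ M} ∩ hardCoreSet (Ov ε) univ)
    (hxi : x i ∉ A) (hy : y ∈ A) (hgood : ∀ l, l ≠ i → ¬ Ov ε (x l) y) :
    update x i y ∈ {x : Fin n → T3 | (∑ l, A.indicator (fun _ => (1 : ℝ)) (x l)) = (j : ℝ) + 1} ∩
      hardCoreSet (Ov ε) univ := by
  refine ⟨?_, floorStat_update_mem_hardCore hx.2 hgood⟩
  have h := floorStat_sum_indicator_update A x i y
  simp only [indicator_of_notMem hxi, indicator_of_mem hy, add_zero] at h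
  rw [hx.1.1] at h
  exact h

/-! ## §3 The excluded volume -/

/-- **Excluded volume.**  If every overlap zone `{y | Ov ε z y}` has volume `≤ V`, overlapping a point of `A`
forces membership in `A⁺`, and `#A⁺(x) ≤ M`, then the part of `A` compatible with the particles `x_l`,
`l ≠ i`, has volume `≥ vol A − M V`: the incompatible part is covered by the `≤ M` zones of the particles
in `A⁺`. -/
theorem floorStat_volume_good_ge {n : ℕ} (ε : ℝ) {A Ap : Set T3} {V : ℝ≥0∞}
    (hV : ∀ z : T3, volume {y : T3 | Ov ε z y} ≤ V) (hcov : ∀ z y, y ∈ A → Ov ε z y → z ∈ Ap)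
    {M : ℝ} {x : Fin n → T3} (hx : (∑ l, Ap.indicator (fun _ => (1 : ℝ)) (x l)) ≤ M) (i : Fin n) :
    volume A - ENNReal.ofReal M * V ≤ volume {y | y ∈ A ∧ ∀ l, l ≠ i → ¬ Ov ε (x l) y} := by
  -- the overlap zones of the particles in `A⁺` cover the incompatible part of `A`
  have hcover :
      A ⊆ {y | y ∈ A ∧ ∀ l, l ≠ i → ¬ Ov ε (x l) y} ∪ ⋃ l, {y | x l ∈ Ap ∧ Ov ε (x l) y} := by
    intro y hy
    by_cases hg : ∀ l, l ≠ i → ¬ Ov ε (x l) y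
    · exact Or.inl ⟨hy, hg⟩
    · push Not at hg
      obtain ⟨l, -, hl⟩ := hg
      exact Or.inr (mem_iUnion.2 ⟨l, hcov _ _ hy hl, hl⟩)
  have hT : ∀ l, volume {y | x l ∈ Ap ∧ Ov ε (x l) y} ≤ Ap.indicator (1 : T3 → ℝ≥0∞) (x l) * V := by
    intro l
    by_cases h : x l ∈ Ap
    · rw [indicator_of_mem h, Pi.one_apply, one_mul]
      exact (measure_mono fun y hy => hy.2).trans (hV (x l))
    · rw [indicator_of_notMem h, zero_mul, nonpos_iff_eq_zero]
      exact measure_mono_null (fun y hy => (h hy.1).elim) measure_empty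
  have hsum : ∑ l, Ap.indicator (1 : T3 → ℝ≥0∞) (x l) * V ≤ ENNReal.ofReal M * V := by
    rw [← Finset.sum_mul, floorStat_sum_indicator_ennreal]
    exact mul_le_mul_left (ENNReal.ofReal_le_ofReal hx) V
  refine tsub_le_iff_right.2 ((measure_mono hcover).trans ((measure_union_le _ _).trans ?_))
  exact add_le_add_right
    (((measure_iUnion_fintype_le _ _).trans (Finset.sum_le_sum fun l _ => hT l)).trans hsum) _

/-! ## §4 The transport inequality for the product measure -/

/-- **Swap transport, product-measure form.**  For measurable `A, A⁺ ⊆ 𝕋³` such that every overlap zone has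
volume `≤ V` and overlapping a point of `A` forces membership in `A⁺`, with `E = {#A = j, #A⁺ ≤ M} ∩ HC`,
`E' = {#A = j+1} ∩ HC` and `ℙ = vol^{⊗n}`:  `(vol A − M V) (n − j) ℙ(E) ≤ (j+1) ℙ(E')`.
Lower bound: for `x ∈ E` each of the `n − j` labels `i` with `xᵢ ∉ A` has a compatible region in `A` of
volume `≥ vol A − M V` (§3), and moving `xᵢ` there lands in `E'` with the `i`-th particle in `A` (§2); swap
identity (§1); upper bound: `∑ᵢ 𝟙_{E'}(x) 𝟙_A(xᵢ) = (j+1) 𝟙_{E'}(x)`. -/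
theorem floorStat_key {n : ℕ} (ε : ℝ) {A Ap : Set T3} (hA : MeasurableSet A) (hAp : MeasurableSet Ap)
    {V : ℝ≥0∞} (hV : ∀ z : T3, volume {y : T3 | Ov ε z y} ≤ V)
    (hcov : ∀ z y, y ∈ A → Ov ε z y → z ∈ Ap) (M : ℝ) (j : ℕ) :
    (volume A - ENNReal.ofReal M * V) * ENNReal.ofReal ((n : ℝ) - j) *
        Measure.pi (fun _ : Fin n => (volume : Measure T3))
          ({x | (∑ l, A.indicator (fun _ => (1 : ℝ)) (x l)) = j ∧
              (∑ l, Ap.indicator (fun _ => (1 : ℝ)) (x l)) ≤ M} ∩ hardCoreSet (Ov ε) univ) ≤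
      ENNReal.ofReal ((j : ℝ) + 1) *
        Measure.pi (fun _ : Fin n => (volume : Measure T3))
          ({x | (∑ l, A.indicator (fun _ => (1 : ℝ)) (x l)) = (j : ℝ) + 1} ∩ hardCoreSet (Ov ε) univ) := by
  classical
  set E := ({x | (∑ l, A.indicator (fun _ => (1 : ℝ)) (x l)) = j ∧
      (∑ l, Ap.indicator (fun _ => (1 : ℝ)) (x l)) ≤ M} ∩ hardCoreSet (Ov ε) univ : Set (Fin n → T3)) with hE
  set E' := ({x | (∑ l, A.indicator (fun _ => (1 : ℝ)) (x l)) = (j : ℝ) + 1} ∩ hardCoreSet (Ov ε) univ :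
      Set (Fin n → T3)) with hE'
  set C := volume A - ENNReal.ofReal M * V with hC
  -- measurability
  have hS : ∀ B : Set T3, MeasurableSet B →
      Measurable fun x : Fin n → T3 => ∑ l, B.indicator (fun _ => (1 : ℝ)) (x l) :=
    fun B hB =>
      Finset.measurable_sum _ fun l _ => (measurable_const.indicator hB).comp (measurable_pi_apply l)
  have hHC : MeasurableSet (hardCoreSet (Ov ε) (univ : Finset (Fin n)) : Set (Fin n → T3)) :=
    measurableSet_hardCoreSet (measurableSet_ov ε) _
  have hEm : MeasurableSet E :=
    ((measurableSet_eq_fun (hS A hA) measurable_const).inter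
      (measurableSet_le (hS Ap hAp) measurable_const)).inter hHC
  have hE'm : MeasurableSet E' := (measurableSet_eq_fun (hS A hA) measurable_const).inter hHC
  have hUm : ∀ i, Measurable fun x : Fin n → T3 =>
      E'.indicator (fun x => A.indicator (1 : T3 → ℝ≥0∞) (x i)) x :=
    fun i => ((measurable_one.indicator hA).comp (measurable_pi_apply i)).indicator hE'm
  have hLm : ∀ i, Measurable fun x : Fin n → T3 =>
      E.indicator (fun x => C * Aᶜ.indicator (1 : T3 → ℝ≥0∞) (x i)) x :=
    fun i => (((measurable_one.indicator hA.compl).comp (measurable_pi_apply i)).const_mul C).indicator hEm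
  -- Step 1: transport along each label
  have hstep : ∀ i, ∫⁻ x, E.indicator (fun x => C * Aᶜ.indicator (1 : T3 → ℝ≥0∞) (x i)) x
        ∂Measure.pi (fun _ : Fin n => (volume : Measure T3)) ≤
      ∫⁻ x, E'.indicator (fun x => A.indicator (1 : T3 → ℝ≥0∞) (x i)) x
        ∂Measure.pi (fun _ : Fin n => (volume : Measure T3)) := by
    intro i
    have hswap := floorStat_lintegral_update_swap (volume : Measure T3)
      (F := fun x _ => E'.indicator (fun x => A.indicator (1 : T3 → ℝ≥0∞) (x i)) x)
      ((hUm i).comp measurable_fst) i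
    simp only [lintegral_const, measure_univ, mul_one] at hswap
    rw [← hswap]
    refine lintegral_mono fun x => ?_
    by_cases hxE : x ∈ E
    · by_cases hxi : x i ∈ A
      · rw [indicator_of_mem hxE, indicator_of_notMem (notMem_compl_iff.2 hxi), mul_zero]
        exact zero_le
      · have hgood : MeasurableSet {y | y ∈ A ∧ ∀ l, l ≠ i → ¬ Ov ε (x l) y} := by
          have h : ∀ l, Measurable fun y : T3 => Ov ε (x l) y := fun l =>
            ((measurableSet_ov ε).preimage (measurable_prodMk_left (x := x l))).mem
          exact measurableSet_setOf.2
            (hA.mem.and (Measurable.forall fun l => measurable_const.imp (h l).not))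
        rw [indicator_of_mem hxE, indicator_of_mem (mem_compl hxi), Pi.one_apply, mul_one]
        calc C ≤ volume {y | y ∈ A ∧ ∀ l, l ≠ i → ¬ Ov ε (x l) y} :=
              floorStat_volume_good_ge ε hV hcov hxE.1.2 i
          _ = ∫⁻ y, {y | y ∈ A ∧ ∀ l, l ≠ i → ¬ Ov ε (x l) y}.indicator 1 y :=
              (lintegral_indicator_one hgood).symm
          _ ≤ _ := lintegral_mono fun y => ?_
        by_cases hy : y ∈ {y | y ∈ A ∧ ∀ l, l ≠ i → ¬ Ov ε (x l) y}
        · rw [indicator_of_mem hy, Pi.one_apply,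
            indicator_of_mem (floorStat_update_mem_layer hxE hxi hy.1 hy.2), update_self,
            indicator_of_mem hy.1, Pi.one_apply]
        · rw [indicator_of_notMem hy]
          exact zero_le
    · rw [indicator_of_notMem hxE]
      exact zero_le
  -- Step 2: the lower bounds sum to `C (n − j) ℙ(E)`
  have hL : ∑ i, ∫⁻ x, E.indicator (fun x => C * Aᶜ.indicator (1 : T3 → ℝ≥0∞) (x i)) x
        ∂Measure.pi (fun _ : Fin n => (volume : Measure T3)) =
      C * ENNReal.ofReal ((n : ℝ) - j) * Measure.pi (fun _ : Fin n => (volume : Measure T3)) E := by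
    rw [← lintegral_finsetSum _ fun i _ => hLm i, ← lintegral_indicator_const hEm]
    refine lintegral_congr fun x => ?_
    by_cases hxE : x ∈ E
    · simp only [indicator_of_mem hxE]
      rw [← Finset.mul_sum, floorStat_sum_indicator_ennreal, floorStat_sum_indicator_compl, hxE.1.1]
    · simp only [indicator_of_notMem hxE, Finset.sum_const_zero]
  -- Step 3: the upper bounds sum to `(j+1) ℙ(E')`
  have hU : ∑ i, ∫⁻ x, E'.indicator (fun x => A.indicator (1 : T3 → ℝ≥0∞) (x i)) x
        ∂Measure.pi (fun _ : Fin n => (volume : Measure T3)) =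
      ENNReal.ofReal ((j : ℝ) + 1) * Measure.pi (fun _ : Fin n => (volume : Measure T3)) E' := by
    rw [← lintegral_finsetSum _ fun i _ => hUm i, ← lintegral_indicator_const hE'm]
    refine lintegral_congr fun x => ?_
    by_cases hxE : x ∈ E'
    · simp only [indicator_of_mem hxE]
      rw [floorStat_sum_indicator_ennreal, hxE.1]
    · simp only [indicator_of_notMem hxE, Finset.sum_const_zero]
  exact hL.symm.trans_le ((Finset.sum_le_sum fun i _ => hstep i).trans_eq hU)

/-! ## §5 The layer inequality for the canonical hard-sphere gas -/

/-- **Layer inequality (swap transport) for the canonical hard-sphere gas.**  For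
`P = posGibbsMeasure 1 ε_N (N+1)`, `ε_N = hsDiameter σ N`, `0 < σ < 1/2`, a minimal-image ball `A = B(c, r)`
with enlargement `A⁺ = B(c, r + ε_N)`, `v = vol B(·, ε_N)`, `M ≥ 0` and `j ∈ ℕ`:
`(vol A − M v) ((N+1) − j) P{#A = j, #A⁺ ≤ M} ≤ (j+1) P{#A = j+1}`.
(`floorStat_key` with `P = Ξ⁻¹ vol^{⊗(N+1)}|_{HC}`, `posGibbsMeasure_eq`; the cases `vol A − M v < 0` and
`j > N + 1` are trivial.) -/
theorem floorStat_layer_ineq {σ : ℝ} (hσ : 0 < σ) (hσ2 : σ < 1 / 2) (N : ℕ) (c : T3) (r M : ℝ)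
    (hM : 0 ≤ M) (j : ℕ) :
    (volume.real {y : T3 | Torus.euclidDist y c < r} -
          M * volume.real {y : T3 | Torus.euclidDist y c < hsDiameter σ N}) *
        (((N : ℝ) + 1) - j) *
        (posGibbsMeasure (fun _ => (1 : ℝ)) (hsDiameter σ N) (N + 1)).real
          {x | (∑ i, ({y : T3 | Torus.euclidDist y c < r}).indicator (fun _ => (1 : ℝ)) (x i)) = j ∧
            (∑ i, ({y : T3 | Torus.euclidDist y c < r + hsDiameter σ N}).indicator
                (fun _ => (1 : ℝ)) (x i)) ≤ M} ≤
      ((j : ℝ) + 1) *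
        (posGibbsMeasure (fun _ => (1 : ℝ)) (hsDiameter σ N) (N + 1)).real
          {x | (∑ i, ({y : T3 | Torus.euclidDist y c < r}).indicator (fun _ => (1 : ℝ)) (x i)) =
            (j : ℝ) + 1} := by
  have hε2 : hsDiameter σ N < 1 / 2 := (hsDiameter_le hσ.le N).trans_lt hσ2
  haveI : IsProbabilityMeasure (posGibbsMeasure (fun _ => (1 : ℝ)) (hsDiameter σ N) (N + 1)) :=
    isProbabilityMeasure_posGibbsMeasure (a₀ := fun _ : T3 => (1 : ℝ)) continuous_const (fun _ => one_pos)
      hσ2.le N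
  -- geometry of the balls
  have hball : ∀ ρ : ℝ, MeasurableSet {y : T3 | Torus.euclidDist y c < ρ} := fun ρ =>
    measurableSet_lt (Torus.continuous_euclidDist.comp (continuous_id.prodMk continuous_const)).measurable
      measurable_const
  have hV : ∀ z : T3, volume {y : T3 | Ov (hsDiameter σ N) z y} ≤
      volume {y : T3 | Torus.euclidDist y c < hsDiameter σ N} := by
    intro z
    simp only [Ov, Torus.euclidDist_comm z]
    rw [Torus.volume_euclidDist_lt hε2 z, Torus.volume_euclidDist_lt hε2 c]
  have hcov : ∀ z y, y ∈ {y : T3 | Torus.euclidDist y c < r} → Ov (hsDiameter σ N) z y →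
      z ∈ {y : T3 | Torus.euclidDist y c < r + hsDiameter σ N} := by
    intro z y hy hzy
    have hzy' : Torus.euclidDist z y < hsDiameter σ N := hzy
    simp only [mem_setOf_eq] at hy ⊢
    have htri := Literature.MathematicalPhysics.KineticTheory.euclidDist_triangle z y c
    linarith
  have hkey := floorStat_key (n := N + 1) (hsDiameter σ N) (hball r) (hball _) hV hcov M j
  rw [Nat.cast_succ] at hkey
  -- the canonical measure is the normalised restricted product measure
  have hHC : MeasurableSet (hardCoreSet (Ov (hsDiameter σ N)) (univ : Finset (Fin (N + 1))) :
      Set (Fin (N + 1) → T3)) := measurableSet_hardCoreSet (measurableSet_ov _) _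
  have hPapp : ∀ s : Set (Fin (N + 1) → T3),
      posGibbsMeasure (fun _ => (1 : ℝ)) (hsDiameter σ N) (N + 1) s =
        ENNReal.ofReal (Xi (profileOf (fun _ : T3 => (1 : ℝ)) continuous_const (fun _ => one_pos))
          (hsDiameter σ N) (N + 1) (N + 1))⁻¹ *
        Measure.pi (fun _ : Fin (N + 1) => (volume : Measure T3))
          (s ∩ hardCoreSet (Ov (hsDiameter σ N)) univ) := by
    intro s
    rw [posGibbsMeasure_eq continuous_const (fun _ => one_pos), profileOf_one_μ, Measure.smul_apply,
      Measure.restrict_apply' hHC, smul_eq_mul]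
  set P := posGibbsMeasure (fun _ => (1 : ℝ)) (hsDiameter σ N) (N + 1) with hP
  set E₀ := ({x | (∑ i, ({y : T3 | Torus.euclidDist y c < r}).indicator (fun _ => (1 : ℝ)) (x i)) = j ∧
      (∑ i, ({y : T3 | Torus.euclidDist y c < r + hsDiameter σ N}).indicator (fun _ => (1 : ℝ)) (x i)) ≤ M} :
      Set (Fin (N + 1) → T3)) with hE₀
  set E₁ := ({x | (∑ i, ({y : T3 | Torus.euclidDist y c < r}).indicator (fun _ => (1 : ℝ)) (x i)) =
      (j : ℝ) + 1} : Set (Fin (N + 1) → T3)) with hE₁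
  have hq : 0 ≤ ((j : ℝ) + 1) * P.real E₁ := mul_nonneg (by positivity) measureReal_nonneg
  -- degenerate case `j > N + 1`: the layer is empty
  by_cases hj : (j : ℝ) ≤ (N : ℝ) + 1
  swap
  · have hempty : E₀ = ∅ := by
      refine eq_empty_of_forall_notMem fun x hx => hj ?_
      rw [← hx.1]
      calc ∑ i, ({y : T3 | Torus.euclidDist y c < r}).indicator (fun _ => (1 : ℝ)) (x i)
          ≤ ∑ _i : Fin (N + 1), (1 : ℝ) :=
            Finset.sum_le_sum fun i _ => indicator_apply_le' (fun _ => le_rfl) fun _ => zero_le_one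
        _ = (N : ℝ) + 1 := by simp
    rw [hempty, measureReal_empty, mul_zero]
    exact hq
  -- degenerate case `vol A < M v`
  by_cases ha : 0 ≤ volume.real {y : T3 | Torus.euclidDist y c < r} -
      M * volume.real {y : T3 | Torus.euclidDist y c < hsDiameter σ N}
  swap
  · push Not at ha
    exact (mul_nonpos_of_nonpos_of_nonneg (mul_nonpos_of_nonpos_of_nonneg ha.le (sub_nonneg.2 hj))
      measureReal_nonneg).trans hq
  -- main case: multiply `hkey` by `Ξ⁻¹` and pass to real numbers
  have hofReal : ENNReal.ofReal (volume.real {y : T3 | Torus.euclidDist y c < r} -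
      M * volume.real {y : T3 | Torus.euclidDist y c < hsDiameter σ N}) =
      volume {y : T3 | Torus.euclidDist y c < r} -
        ENNReal.ofReal M * volume {y : T3 | Torus.euclidDist y c < hsDiameter σ N} := by
    rw [ENNReal.ofReal_sub _ (mul_nonneg hM measureReal_nonneg), ENNReal.ofReal_mul hM, ofReal_measureReal,
      ofReal_measureReal]
  have h2 : ENNReal.ofReal (volume.real {y : T3 | Torus.euclidDist y c < r} -
        M * volume.real {y : T3 | Torus.euclidDist y c < hsDiameter σ N}) *
      ENNReal.ofReal (((N : ℝ) + 1) - j) * P E₀ ≤ ENNReal.ofReal ((j : ℝ) + 1) * P E₁ := by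
    rw [hPapp, hPapp, hofReal]
    calc _ = ENNReal.ofReal (Xi (profileOf (fun _ : T3 => (1 : ℝ)) continuous_const (fun _ => one_pos))
          (hsDiameter σ N) (N + 1) (N + 1))⁻¹ * ((volume {y : T3 | Torus.euclidDist y c < r} -
            ENNReal.ofReal M * volume {y : T3 | Torus.euclidDist y c < hsDiameter σ N}) *
          ENNReal.ofReal (((N : ℝ) + 1) - j) *
          Measure.pi (fun _ : Fin (N + 1) => (volume : Measure T3))
            (E₀ ∩ hardCoreSet (Ov (hsDiameter σ N)) univ)) := by ring
      _ ≤ _ := mul_le_mul_right hkey _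
      _ = _ := by ring
  have h3 := ENNReal.toReal_mono (ENNReal.mul_ne_top ENNReal.ofReal_ne_top (measure_ne_top _ _)) h2
  simp only [ENNReal.toReal_mul, ENNReal.toReal_ofReal ha, ENNReal.toReal_ofReal (sub_nonneg.2 hj),
    ENNReal.toReal_ofReal (by positivity : (0 : ℝ) ≤ (j : ℝ) + 1)] at h3
  exact h3

/-- **Layer inequality, quantifier form** — the interface `KI` of the lead's wave (registered sub-goal
`floorStat_layer_hKI` of `stub_floorFixed`'s equilibrium rung, consumed by the sibling floor-statics tail file):
for all `0 < σ < 1/2`, `N`, `c`, `r`, `M ≥ 0`, `j`, the inequality `floorStat_layer_ineq`. -/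
theorem floorStat_layer_hKI :
    ∀ (σ : ℝ), 0 < σ → σ < 1 / 2 → ∀ (N : ℕ) (c : T3) (r M : ℝ), 0 ≤ M → ∀ (j : ℕ),
      (volume.real {y : T3 | Torus.euclidDist y c < r} -
            M * volume.real {y : T3 | Torus.euclidDist y c < hsDiameter σ N}) *
          (((N : ℝ) + 1) - j) *
          (posGibbsMeasure (fun _ => (1 : ℝ)) (hsDiameter σ N) (N + 1)).real
            {x | (∑ i, ({y : T3 | Torus.euclidDist y c < r}).indicator (fun _ => (1 : ℝ)) (x i)) = j ∧
              (∑ i, ({y : T3 | Torus.euclidDist y c < r + hsDiameter σ N}).indicator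
                  (fun _ => (1 : ℝ)) (x i)) ≤ M} ≤
        ((j : ℝ) + 1) *
          (posGibbsMeasure (fun _ => (1 : ℝ)) (hsDiameter σ N) (N + 1)).real
            {x | (∑ i, ({y : T3 | Torus.euclidDist y c < r}).indicator (fun _ => (1 : ℝ)) (x i)) =
              (j : ℝ) + 1} :=
  fun _ hσ hσ2 N c r M hM j => floorStat_layer_ineq hσ hσ2 N c r M hM j

end Summit.AtomisticToContinuum.HydrodynamicLimit.Theorems.AdiabatCeiling

end
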